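import Summits.QuantumFields.BalabanUV.T4Continuum.Support.BlockPairingGeometry

/-!
# T⁴ programme, spine node NE2 (U1a) — BLOCK PAIRING FACES: the far face of an `R`-block holds `R^{d−1}` of its `R^d` sites —
# `J_RᴴF_μJ_R = R⁻¹·1`, `Π·(R·F_μ − 1)·J_R = 0` — and the norms of the face weights and of `𝒢∇_μ`

Ninth generation of the NE2 prover lineage P1 of the cell `pub-balaban`, file 6b (companion of `Support/BlockPairingGeometry`, split
for the 400-line rule).  Exact finite combinatorics of the `R`-blocks ([King1986] (2.10) «B^k(y)») plus three norm bounds: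

 * §3 THE ONE COUNT: `Σ_{j ∈ (Fin R)^d} g(j_μ) = R^{d−1}Σ_r g(r)` (`sum_pi_eval`, product of sums), `#{j : R ∣ j_μ + 1} = R^{d−1}`
   (`sum_indicator_face`), whence **`JKH_mul_faceF_mul_JK`** `J_RᴴF_μJ_R = R⁻¹·1` (the block average of the far-face indicator is
   `1/R`) and **`Pi_mul_face_defect_mul_JK`** `Π·(R·F_μ − 1)·J_R = 0` (the weight `R·𝟙_{face} − 1` has block mean zero, so the
   block-oscillating part of a fine derivative of a block-constant field has no block-constant component).
 * §4 norms: `‖F_μ‖ ≤ 1`, `‖R·F_μ − 1‖ ≤ R + 1`, **`opNorm_calG_mul_fdiff_le`** `‖𝒢^{(η)}∇_μ‖ ≤ Cst` (from the printed (1.89) item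
   `‖𝒢∇_μ*‖ ≤ Cst` in the tree and `∇ = −∇ᴴS`).

HONEST FRAMING (T4-DAG p. 1).  [folklore] lattice bookkeeping, OURS; `U = 1` objects only; nothing printed is a hypothesis; NOT
infinite volume / mass gap / Clay / summit progress; spine 0/9 unchanged.  HONEST DEPENDENCY: continuum YM on T⁴ ⇐ BetaPertH ∧ nine
spine estimates (0/9 proved); BetaPertH ⇐ (D1) ∧ (D4) ∧ CAP+tail; G-an2-4 gates asym, D1 and NE2/3/4.  ABSOLUTE RULE kept; no
`sorry`.
-/

noncomputable section

open scoped BigOperators ComplexConjugate Matrix Matrix.Norms.L2Operator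

namespace Summit.QuantumFields.BalabanUV.T4Continuum.BlockPairingFaces

open Literature.MathematicalPhysics.QuantumFieldTheory.Balaban1983to89.B5Prop11Plancherel
open Literature.MathematicalPhysics.QuantumFieldTheory.Balaban1983to89.B5G183RateTorus (cpt)
open Literature.MathematicalPhysics.QuantumFieldTheory.Balaban1983to89.B5G183RateTorusW
open Summit.QuantumFields.BalabanUV.T4Continuum.BalabanAveragedTowerModes (par rem val_par cpt_par_add_off_rem par_cpt_add_off
  rem_cpt_add_off eq_par_rem_of_eq)
open Summit.QuantumFields.BalabanUV.T4Continuum.BalabanBlockPoincare (Pi transl transl_mul_apply transl_eq_iff opNorm_transl_le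
  shiftM_eq_transl Qavg_conjTranspose_mul_apply)
open Summit.QuantumFields.BalabanUV.T4Continuum.KingPairingPlantedLaw
open Summit.QuantumFields.BalabanUV.T4Continuum.BlockPairingGeometry

variable {d : ℕ}

/-! ## §3 The one count: the far face holds `R^{d−1}` of the `R^d` sites of a block -/

section Count

variable (N R : ℕ) [NeZero N] [NeZero R] (M : Fin d → ℕ) [hM : ∀ μ, NeZero (M μ)]

omit [NeZero N] [NeZero R] hM in
/-- `Σ_{j ∈ (Fin R)^d} g(j_μ) = R^{d−1}·Σ_{r} g(r)` (product of sums). [folklore] -/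
theorem sum_pi_eval (g : Fin R → ℂ) (μ : Fin d) :
    ∑ j : Fin d → Fin R, g (j μ) = ((R : ℂ)) ^ (d - 1) * ∑ r : Fin R, g r := by
  classical
  have h := Finset.prod_univ_sum (fun _ : Fin d => (Finset.univ : Finset (Fin R)))
    (fun ν r => if ν = μ then g r else (1 : ℂ))
  rw [Fintype.piFinset_univ] at h
  have lhs : (∏ ν : Fin d, ∑ r : Fin R, if ν = μ then g r else (1 : ℂ)) = ((R : ℂ)) ^ (d - 1) * ∑ r : Fin R, g r := by
    rw [← Finset.mul_prod_erase Finset.univ _ (Finset.mem_univ μ)]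
    simp only [if_true]
    have hrest : ∀ ν ∈ Finset.univ.erase μ, (∑ r : Fin R, if ν = μ then g r else (1 : ℂ)) = (R : ℂ) := by
      intro ν hν
      simp only [Finset.ne_of_mem_erase hν, if_false, Finset.sum_const, Finset.card_univ, Fintype.card_fin, nsmul_eq_mul,
        mul_one]
    rw [Finset.prod_congr rfl hrest, Finset.prod_const, Finset.card_erase_of_mem (Finset.mem_univ μ), Finset.card_univ,
      Fintype.card_fin, mul_comm]
  have rhs : (∑ j : Fin d → Fin R, ∏ ν : Fin d, if ν = μ then g (j ν) else (1 : ℂ)) = ∑ j : Fin d → Fin R, g (j μ) := by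
    refine Finset.sum_congr rfl fun j _ => ?_
    rw [Finset.prod_ite_eq']
    simp
  rw [← rhs, ← h, lhs]

omit [NeZero N] hM in
/-- among `r ∈ {0,…,R−1}` exactly one has `R ∣ r + 1`. [folklore] -/
theorem sum_indicator_dvd : ∑ r : Fin R, (if R ∣ (r : ℕ) + 1 then (1 : ℂ) else 0) = 1 := by
  have hR : 0 < R := Nat.pos_of_ne_zero (NeZero.ne R)
  rw [Finset.sum_eq_single (⟨R - 1, Nat.sub_lt hR one_pos⟩ : Fin R)]
  · show (if R ∣ (R - 1) + 1 then (1 : ℂ) else 0) = 1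
    rw [Nat.sub_add_cancel hR, if_pos (dvd_refl R)]
  · intro r _ hr
    rw [if_neg]
    intro hdvd
    apply hr
    apply Fin.ext
    have h1 : (r : ℕ) + 1 ≤ R := r.isLt
    have h2 := Nat.le_of_dvd (Nat.succ_pos _) hdvd
    simp only
    omega
  · intro h; exact absurd (Finset.mem_univ _) h

omit [NeZero N] hM in
/-- `Σ_j [R ∣ j_μ + 1] = R^{d−1}`. [folklore] -/
theorem sum_indicator_face (μ : Fin d) :
    ∑ j : Fin d → Fin R, (if R ∣ (j μ : ℕ) + 1 then (1 : ℂ) else 0) = ((R : ℂ)) ^ (d - 1) := by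
  rw [sum_pi_eval R (fun r : Fin R => if R ∣ (r : ℕ) + 1 then (1 : ℂ) else 0) μ, sum_indicator_dvd, mul_one]

/-- **`J_Rᴴ F_μ J_R = R⁻¹·1`**: the block average of the far-face indicator is `1/R`. [cite: King1986, (2.10) p.653] [folklore] -/
theorem JKH_mul_faceF_mul_JK (hd : 1 ≤ d) (μ : Fin d) : (JK N R M)ᴴ * faceF N R M μ * JK N R M = ((R : ℂ))⁻¹ • 1 := by
  have hRc : (R : ℂ) ≠ 0 := by exact_mod_cast NeZero.ne R
  have hRd : ((R : ℂ) ^ d) ≠ 0 := pow_ne_zero _ hRc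
  obtain ⟨hs, hss⟩ := sqrt_facts (d := d) R
  -- reduce to `Q F Qᴴ`
  have e1 : (JK N R M)ᴴ * faceF N R M μ * JK N R M = ((R : ℂ) ^ d) • (Qavg N R M * (faceF N R M μ * (Qavg N R M)ᴴ)) := by
    rw [JK, Matrix.conjTranspose_smul, Matrix.conjTranspose_conjTranspose, hs, Matrix.smul_mul, Matrix.smul_mul, Matrix.mul_smul,
      smul_smul, hss, Matrix.mul_assoc]
  rw [e1]
  ext i b
  rw [Matrix.smul_apply, Qavg_mul_apply, Matrix.smul_apply, Matrix.one_apply, smul_eq_mul, smul_eq_mul]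
  have hterm : ∀ j : Fin d → Fin R, (faceF N R M μ * (Qavg N R M)ᴴ) (cpt N R M i.1 + off N R M j, i.2) b
      = ((R : ℂ) ^ d)⁻¹ * (if i = b then 1 else 0) * (if R ∣ (j μ : ℕ) + 1 then 1 else 0) := by
    intro j
    rw [faceF, Matrix.diagonal_mul]
    have hq := Qavg_conjTranspose_mul_apply N R M (1 : Matrix _ _ ℂ) (cpt N R M i.1 + off N R M j, i.2) b
    rw [Matrix.mul_one] at hq
    have hib : ((i.1, i.2) = b) ↔ (i = b) := by simp [Prod.ext_iff]
    simp only [hq, par_cpt_add_off, Matrix.one_apply, face_cpt_add_off_iff, hib]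
    ring
  simp_rw [hterm]
  rw [← Finset.mul_sum, sum_indicator_face R μ]
  have hpow : (R : ℂ) ^ d = (R : ℂ) ^ (d - 1) * R := by rw [← pow_succ, Nat.sub_add_cancel hd]
  have key2 : ((R : ℂ) ^ d)⁻¹ * (R : ℂ) ^ (d - 1) = (R : ℂ)⁻¹ := by
    rw [hpow]; field_simp
  by_cases hib : i = b
  · rw [if_pos hib, mul_one, mul_one, ← mul_assoc, mul_inv_cancel₀ hRd, one_mul, key2]
  · rw [if_neg hib]; simp

/-- **`Π·(R·F_μ − 1)·J_R = 0`**: the weight `R·𝟙_{far face} − 1` has zero mean on every block, so it annihilates block means of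
block-constant fields. [folklore] -/
theorem Pi_mul_face_defect_mul_JK (hd : 1 ≤ d) (μ : Fin d) :
    Pi N R M * (((R : ℂ)) • faceF N R M μ - 1) * JK N R M = 0 := by
  have hRc : (R : ℂ) ≠ 0 := by exact_mod_cast NeZero.ne R
  rw [← JK_mul_conjTranspose, Matrix.mul_assoc, Matrix.mul_assoc, Matrix.sub_mul, Matrix.one_mul, Matrix.smul_mul, Matrix.mul_sub,
    Matrix.mul_smul, ← Matrix.mul_assoc (JK N R M)ᴴ, JKH_mul_faceF_mul_JK N R M hd μ, JK_conjTranspose_mul_JK, smul_smul,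
    mul_inv_cancel₀ hRc, one_smul, sub_self, Matrix.mul_zero]

end Count

/-! ## §4 Norms -/

section Norms

variable (N R : ℕ) [NeZero N] [NeZero R] (M : Fin d → ℕ) [hM : ∀ μ, NeZero (M μ)]

/-- `‖F_μ‖ ≤ 1`. [folklore] -/
theorem opNorm_faceF_le (μ : Fin d) : ‖faceF N R M μ‖ ≤ 1 := by
  refine opNorm_diagonal_le (fine (R * N) M) zero_le_one fun i => ?_
  split_ifs <;> simp

/-- `‖R·F_μ − 1‖ ≤ R + 1`. [folklore] -/
theorem opNorm_face_defect_le (μ : Fin d) : ‖((R : ℂ)) • faceF N R M μ - 1‖ ≤ R + 1 := by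
  refine (norm_sub_le _ _).trans (add_le_add ?_ (BackgroundResolventLaw.l2_opNorm_one_le))
  rw [norm_smul, Complex.norm_natCast]
  calc (R : ℝ) * ‖faceF N R M μ‖ ≤ R * 1 := mul_le_mul_of_nonneg_left (opNorm_faceF_le N R M μ) (Nat.cast_nonneg R)
    _ = R := mul_one _

variable (a : ℝ) (ha : 0 < a)

/-- **`‖𝒢^{(η)}∇_μ‖ ≤ Cst`** — from the printed (1.89) item `‖𝒢∇_μ*‖ ≤ Cst` (tree) and `∇ = −∇ᴴS`. [cite: Balaban1984PropagatorsI,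
Prop. 1.1 (1.89) p.33] [folklore] -/
theorem opNorm_calG_mul_fdiff_le (hN : 1 ≤ N) (μ : Fin d) :
    ‖calG N hN M a ha * fdiff (fine N M) ((N : ℕ) : ℂ) μ‖ ≤ Cst d a := by
  have e : ((N : ℕ) : ℂ) = ((N : ℝ) : ℂ) := by push_cast; rfl
  rw [e, fdiff_eq_neg_conjTranspose_mul, Matrix.mul_neg, norm_neg, ← Matrix.mul_assoc]
  have h1 : ‖calG N hN M a ha * (fdiff (fine N M) ((N : ℝ) : ℂ) μ)ᴴ‖ ≤ Cst d a := by
    rw [← e]; exact opNorm_calG_star_fdiff_le N hN M a ha μ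
  calc _ ≤ ‖calG N hN M a ha * (fdiff (fine N M) ((N : ℝ) : ℂ) μ)ᴴ‖ * ‖shiftM (fine N M) μ‖ := Matrix.l2_opNorm_mul _ _
    _ ≤ Cst d a * 1 := mul_le_mul h1 (opNorm_shiftM_le _ μ) (norm_nonneg _) (Cst_nonneg d a)
    _ = Cst d a := mul_one _

end Norms

end Summit.QuantumFields.BalabanUV.T4Continuum.BlockPairingFaces

end
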